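import Literature.NumberTheory.EllipticCurves.GrossPointsTowerExistence
import Literature.NumberTheory.EllipticCurves.GrossPointsBrandtDictionary
import HarnessLib

/-!
# Gross points of conductor `1` exist on a Brandt set-up of type `(N⁺, N⁻)` for ANY level `N⁺`
# (Eichler–Hijikata optimal embeddings at a split prime of arbitrary exponent; BD96 Lemma 2.1)

Topic `NumberTheory/EllipticCurves`, sequel of `GrossPointsTowerExistence.lean` (which proves the
existence of Gross points — and of towers of them — for SQUARE-FREE `N = N⁺N⁻`, the only use of
square-freeness being the local model of the Eichler order at `q ∥ N⁺`).  THEOREMS ONLY (no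
definition, no named fact, no `sorry`, no instance).

We remove the square-free hypothesis on `N⁺`: for a Brandt set-up `S : Brandt.XiSetup N⁺ N⁻`
(definite quaternion algebra of discriminant `N⁻`, Eichler order `S.O` of level `N⁺ ≥ 1`) and an
imaginary quadratic field `K` with `(N⁺N⁻, d_K) = 1`, every prime of `N⁺` SPLIT and every prime of
`N⁻` INERT in `K`, there is a Gross point of conductor `1`: an embedding `ψ : K → S.D` and an
invertible right `S.O`-ideal `I` with `ψ` an OPTIMAL embedding of `𝓞_K` into the left order
`O_L(I)` (`Brandt.IsGrossPoint S.O ψ I`; equivalently `[⟨ψ, I⟩] ∈ grossPoints K S 1`, BD96's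
`H_{N⁺,N⁻}(K; 1) ≠ ∅`).

* §1 `exists_optimalOrder_smul_eq_of_eichler_of_root` — the NEW LOCAL INPUT, generic: at a prime `q`
  where the order has an Eichler matrix model of level `q^e`, `O_(q) = Φ⁻¹(ℤ_q ℤ_q; q^e ℤ_q ℤ_q)`
  (ANY `e ≥ 0`), and `γ² = m + tγ` has a `q`-adically integral root `λ` (i.e. `q` splits — or
  ramifies — in `ℚ(γ)` with `λ ∈ ℤ_q`), the order `ℤ ⊕ ℤγ` is the optimal order of some local ideal
  `x O_(q)`.  Proof: with a cyclic vector `v` of `A = Φ(γ)` and `w = (A − λ)v`, the matrix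
  `P = (w | v)` conjugates `A` to the UPPER-TRIANGULAR `T = (t−λ, 1; 0, λ)`; a global `x` with
  `Φ(x) ∈ P · (Eichler units)` exists by density (`AlgHom.exists_norm_sub_le`,
  `Padic.eichler_of_norm_sub_one_le`); then `h = r + sγ` stabilises `x O_(q)` iff
  `P⁻¹Φ(h)P = (r + s(t−λ), s; 0, r + sλ)` is an Eichler matrix iff `r, s ∈ ℤ_(q)` — independently
  of `e` (Hijikata 1974 §2: the embedding numbers of the maximal order of `ℚ_q × ℚ_q` into the
  Eichler order of level `q^e` are positive for every `e`).
* §2 `exists_padic_root_of_ncard_primesOver_eq_two` — a split prime gives a `q`-adic integral root of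
  `X² − tX − m` (`d_K = t² + 4m` is a `q`-adic square: decomposition law + Hensel, tree lemmas).
* §3 `exists_local_general` — local optimal embeddings of `f(𝓞_K)` at EVERY prime for arbitrary
  `N⁺` (the cases `q ∤ N` and `q ∣ N⁻` are the tree's `exists_local_of_not_dvd` /
  `exists_local_of_dvd_nminus`; `q ∣ N⁺` is §1 with the level model
  `IsEichlerOrder.exists_conjUnit_localAt_iff_eichler` of exponent `v_q(N⁺)`).
* §4 `exists_isGrossPoint` / `grossPoints_one_nonempty` — gluing (the tree's
  `exists_invertible_optimalOrder_eq`, Vignéras III.5.11) and the dictionary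
  `isGrossPoint_iff_isHeegner_one`.

References: M.-F. Vignéras, LNM 800, Ch. II §3, Ch. III §5 Thm. 5.11–Cor. 5.12 [VignerasLNM800];
H. Hijikata, J. Math. Soc. Japan 26 (1974) §2 [Hijikata1974]; M. Bertolini, H. Darmon, Invent. Math.
126 (1996) Lemma 2.1 [BertoliniDarmon1996]; B. H. Gross, *Heights and the special values of
L-series* (1987) §3 [Gross1987].
-/

noncomputable section

open scoped Pointwise Matrix
open NumberField Module IsDedekindDomain
open Literature.NumberTheory.QuadraticFields.Quadratic
open Literature.NumberTheory.Automorphic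

universe u

namespace Literature.NumberTheory.EllipticCurves

namespace GrossPointsGeneralLevel

/-! ### §1 The local input at a split prime of arbitrary exponent -/

section Local

variable {D : Type u} [Ring D] [Algebra ℚ D] [IsQuaternionAlgebra ℚ D] {q : ℕ} [hq : Fact q.Prime]

/-- Entries of `M v`: `(M v)_i = M_{i0} v_0 + M_{i1} v_1`. [folklore] -/
private theorem mulVec_apply_two (M : Matrix (Fin 2) (Fin 2) ℚ_[q]) (x : Fin 2 → ℚ_[q]) (i : Fin 2) :
    (M *ᵥ x) i = M i 0 * x 0 + M i 1 * x 1 := by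
  simp [Matrix.mulVec, dotProduct, Fin.sum_univ_two]

/-- The upper-triangular matrices `(r + sλ₁, s; 0, r + sλ₂)` with `λ₁, λ₂ ∈ ℤ_q` are Eichler matrices
of level `q^e` exactly when `r, s ∈ ℤ_q`. [folklore] -/
private theorem eichler_triangular_iff {e : ℕ} {lam₁ lam₂ : ℚ_[q]} (h₁ : ‖lam₁‖ ≤ 1) (h₂ : ‖lam₂‖ ≤ 1)
    (r s : ℚ_[q]) :
    ((∀ i j, ‖(!![r + s * lam₁, s; 0, r + s * lam₂] : Matrix (Fin 2) (Fin 2) ℚ_[q]) i j‖ ≤ 1) ∧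
        ‖(!![r + s * lam₁, s; 0, r + s * lam₂] : Matrix (Fin 2) (Fin 2) ℚ_[q]) 1 0‖ ≤
          (q : ℝ) ^ (-(e : ℤ))) ↔
      ‖r‖ ≤ 1 ∧ ‖s‖ ≤ 1 := by
  have hq0 : (0 : ℝ) ≤ (q : ℝ) ^ (-(e : ℤ)) := zpow_nonneg (Nat.cast_nonneg _) _
  constructor
  · rintro ⟨h, -⟩
    have hs : ‖s‖ ≤ 1 := by simpa using h 0 1
    have hrs : ‖r + s * lam₂‖ ≤ 1 := by simpa using h 1 1
    refine ⟨?_, hs⟩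
    have e1 : r = (r + s * lam₂) + -(s * lam₂) := by ring
    rw [e1]
    refine (Padic.nonarchimedean _ _).trans (max_le hrs ?_)
    rw [norm_neg, norm_mul]
    exact mul_le_one₀ hs (norm_nonneg _) h₂
  · rintro ⟨hr, hs⟩
    have hb : ∀ lam : ℚ_[q], ‖lam‖ ≤ 1 → ‖r + s * lam‖ ≤ 1 := fun lam hl =>
      (Padic.nonarchimedean _ _).trans (max_le hr (by rw [norm_mul]; exact mul_le_one₀ hs (norm_nonneg _) hl))
    refine ⟨fun i j => ?_, by simp⟩
    fin_cases i <;> fin_cases j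
    · simpa using hb lam₁ h₁
    · simpa using hs
    · simp
    · simpa using hb lam₂ h₂

/-- **Optimal embedding of `ℤ[γ]` into an Eichler order of level `q^e` at a prime where `γ` has a
`q`-adic integral eigenvalue** (Eichler 1955 / Hijikata 1974 §2: at a prime `q` split in `ℚ(γ)` the
maximal order — indeed any order `ℤ ⊕ ℤγ` with `γ² = m + tγ`, `X² − tX − m` having a root in `ℤ_q` —
embeds optimally into the Eichler order of level `q^e` for EVERY `e ≥ 0`).  In the tree's language
(`EichlerEmbeddingLocalGlobal`): if `O_(q) = Φ⁻¹(ℤ_q ℤ_q; q^e ℤ_q ℤ_q)` for a matrix model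
`Φ : D → M₂(ℚ_q)`, then some local ideal `x O_(q)`, `x ∈ Dˣ`, has optimal order
`(ℤ ⊕ ℤγ)_(q)`.  Proof: conjugate `Φ(γ)` to the upper-triangular `(t − λ, 1; 0, λ)` by `P = (w | v)`,
`v` a cyclic vector, `w = (Φ(γ) − λ)v`; realise `P` up to an Eichler unit by a global `x` (density);
then `r + sγ ∈ O_L(x O_(q))` iff `(r + s(t−λ), s; 0, r + sλ)` is an Eichler matrix iff `r, s ∈ ℤ_(q)`.
[cite: Hijikata1974, §2] [cite: VignerasLNM800, Ch. II §3; Ch. III §5 Cor. 5.12] -/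
theorem exists_optimalOrder_smul_eq_of_eichler_of_root
    (Φ : D →ₐ[ℚ] Matrix (Fin 2) (Fin 2) ℚ_[q]) (hD : ∀ x : D, x ≠ 0 → IsUnit x)
    {O : Submodule ℤ D} {e : ℕ}
    (hO : ∀ y : D, y ∈ localAt q O ↔ (∀ i j, ‖Φ y i j‖ ≤ 1) ∧ ‖Φ y 1 0‖ ≤ (q : ℝ) ^ (-(e : ℤ)))
    (hO1 : (1 : D) ∈ O) (hOmul : ∀ a ∈ O, ∀ b ∈ O, a * b ∈ O)
    {γ : D} (hγ : γ ∉ (⊥ : Subalgebra ℚ D)) {t m : ℤ}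
    (hγ2 : γ * γ = algebraMap ℚ D (m : ℚ) + ((t : ℚ)) • γ)
    {lam : ℚ_[q]} (hlam1 : ‖lam‖ ≤ 1) (hlam : lam * lam = (m : ℚ_[q]) + (t : ℚ_[q]) * lam)
    {B : Submodule ℤ D} (hBσ : ∀ b : D, b ∈ B ↔ ∃ u v : ℤ, b = algebraMap ℚ D u + v • γ) :
    ∃ x : Dˣ, Brandt.optimalOrder (x • localAt q O) γ = localAt q B := by
  have hq0 : (0 : ℝ) < q := by exact_mod_cast hq.out.pos
  -- the matrix `A = Φ(γ)` and its quadratic relation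
  set A : Matrix (Fin 2) (Fin 2) ℚ_[q] := Φ γ with hAdef
  have hA2 : A * A = (m : ℚ_[q]) • (1 : Matrix (Fin 2) (Fin 2) ℚ_[q]) + (t : ℚ_[q]) • A := by
    have h := congrArg Φ hγ2
    rw [map_mul, map_add, map_smul, AlgHom.commutes, Algebra.algebraMap_eq_smul_one,
      ← algebraMap_smul ℚ_[q] (m : ℚ), ← algebraMap_smul ℚ_[q] (t : ℚ) (Φ γ), eq_ratCast, eq_ratCast,
      Rat.cast_intCast, Rat.cast_intCast] at h
    exact h
  -- the two eigenvalues `λ₁ = t − λ`, `λ₂ = λ`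
  set lam₁ : ℚ_[q] := (t : ℚ_[q]) - lam with hlam₁def
  have hlam₁1 : ‖lam₁‖ ≤ 1 := by
    rw [hlam₁def, sub_eq_add_neg]
    refine (Padic.nonarchimedean _ _).trans (max_le (Padic.norm_int_le_one t) ?_)
    rw [norm_neg]; exact hlam1
  have hprod : lam₁ * lam = -(m : ℚ_[q]) := by
    rw [hlam₁def]; linear_combination (-1 : ℚ_[q]) * hlam
  -- a cyclic vector `v`, the eigenvector `w = (A − λ) v` for `λ₁`, the matrix `P = (w | v)`
  obtain ⟨v, hv⟩ := Brandt.exists_vdet_mulVec_ne_zero (Brandt.map_ne_smul_one Φ hD hγ)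
  set w : Fin 2 → ℚ_[q] := A *ᵥ v - lam • v with hwdef
  have hAw : A *ᵥ w = lam₁ • w := by
    have h1 : A *ᵥ w = (m : ℚ_[q]) • v + (t : ℚ_[q]) • (A *ᵥ v) - lam • (A *ᵥ v) := by
      rw [hwdef, Matrix.mulVec_sub, Matrix.mulVec_smul, Matrix.mulVec_mulVec, hA2, Matrix.add_mulVec,
        Matrix.smul_mulVec, Matrix.smul_mulVec, Matrix.one_mulVec]
    have h2 : lam₁ • w = lam₁ • (A *ᵥ v) + (m : ℚ_[q]) • v := by
      rw [hwdef, smul_sub, smul_smul, hprod, neg_smul, sub_neg_eq_add]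
    rw [h1, h2, hlam₁def, sub_smul]
    abel
  have hAw' : ∀ i, A i 0 * w 0 + A i 1 * w 1 = lam₁ * w i := fun i => by
    have h := congrFun hAw i
    rwa [mulVec_apply_two, Pi.smul_apply, smul_eq_mul] at h
  have hAv' : ∀ i, A i 0 * v 0 + A i 1 * v 1 = w i + lam * v i := fun i => by
    have h : w i = (A *ᵥ v) i - lam * v i := by
      rw [hwdef, Pi.sub_apply, Pi.smul_apply, smul_eq_mul]
    rw [← mulVec_apply_two, h]; ring
  set P : Matrix (Fin 2) (Fin 2) ℚ_[q] := !![w 0, v 0; w 1, v 1] with hPdef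
  have hdetP : P.det = -Brandt.vdet v (A *ᵥ v) := by
    rw [hPdef, Matrix.det_fin_two_of, Brandt.vdet]
    have h0 : w 0 = (A *ᵥ v) 0 - lam * v 0 := by rw [hwdef, Pi.sub_apply, Pi.smul_apply, smul_eq_mul]
    have h1 : w 1 = (A *ᵥ v) 1 - lam * v 1 := by rw [hwdef, Pi.sub_apply, Pi.smul_apply, smul_eq_mul]
    rw [h0, h1]; ring
  have hPunit : IsUnit P.det := by
    rw [isUnit_iff_ne_zero, hdetP, neg_ne_zero]; exact hv
  -- `A P = P T`, `T = (λ₁, 1; 0, λ)` upper triangular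
  set T : Matrix (Fin 2) (Fin 2) ℚ_[q] := !![lam₁, 1; 0, lam] with hTdef
  have hAP : A * P = P * T := by
    ext i j
    fin_cases i <;> fin_cases j <;>
      simp [Matrix.mul_apply, Fin.sum_univ_two, hPdef, hTdef] <;>
      first
        | linear_combination hAw' 0
        | linear_combination hAv' 0
        | linear_combination hAw' 1
        | linear_combination hAv' 1
  -- `P⁻¹ Φ(r + sγ) P = (r + sλ₁, s; 0, r + sλ)`
  have hconj : ∀ r s : ℚ, P⁻¹ * Φ (algebraMap ℚ D r + s • γ) * P =
      !![(r : ℚ_[q]) + (s : ℚ_[q]) * lam₁, (s : ℚ_[q]); 0, (r : ℚ_[q]) + (s : ℚ_[q]) * lam] := by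
    intro r s
    have hΦ : Φ (algebraMap ℚ D r + s • γ) = (r : ℚ_[q]) • (1 : Matrix (Fin 2) (Fin 2) ℚ_[q]) + (s : ℚ_[q]) • A := by
      rw [map_add, map_smul, AlgHom.commutes, Algebra.algebraMap_eq_smul_one, ← algebraMap_smul ℚ_[q] r,
        ← algebraMap_smul ℚ_[q] s (Φ γ), eq_ratCast, eq_ratCast]
    have hmul : Φ (algebraMap ℚ D r + s • γ) * P = P * ((r : ℚ_[q]) • 1 + (s : ℚ_[q]) • T) := by
      rw [hΦ, add_mul, smul_mul_assoc, smul_mul_assoc, one_mul, hAP, mul_add, mul_smul_comm,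
        mul_smul_comm, mul_one]
    rw [mul_assoc, hmul, Matrix.nonsing_inv_mul_cancel_left _ _ hPunit, hTdef]
    ext i j
    fin_cases i <;> fin_cases j <;> simp [mul_comm]
  -- a global `x` with `Φ(x) = P k`, `k` an Eichler unit of level `q^e` (density)
  obtain ⟨C, hC⟩ := Padic.exists_forall_norm_apply_le_pow P⁻¹
  obtain ⟨b₀, hb₀⟩ := AlgHom.exists_norm_sub_le Φ P (C + (e + 1))
  set k : Matrix (Fin 2) (Fin 2) ℚ_[q] := P⁻¹ * Φ b₀ with hkdef
  have h1 : ∀ i j, ‖(1 : Matrix (Fin 2) (Fin 2) ℚ_[q]) i j‖ ≤ 1 := fun i j => by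
    rw [Matrix.one_apply]; split_ifs <;> simp
  have hk1 : k - 1 = P⁻¹ * (Φ b₀ - P) * 1 := by
    rw [mul_one, mul_sub, Matrix.nonsing_inv_mul _ hPunit]
  have hkn : ∀ i j, ‖(k - 1) i j‖ ≤ (q : ℝ) ^ (-((e + 1 : ℕ) : ℤ)) := by
    intro i j
    rw [hk1]
    refine (Padic.norm_mul_mul_apply_le hC hb₀ h1 (pow_nonneg hq0.le _)
      (zpow_nonneg hq0.le _) i j).trans (le_of_eq ?_)
    rw [mul_one, ← zpow_natCast, ← zpow_add₀ hq0.ne']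
    congr 1
    push_cast
    ring
  obtain ⟨hk, hkinv, hkdet⟩ := Padic.eichler_of_norm_sub_one_le hkn
  have hkdet' : IsUnit k.det := isUnit_iff_ne_zero.mpr fun h => by
    rw [h, norm_zero] at hkdet; exact zero_ne_one hkdet
  have hΦb₀ : Φ b₀ = P * k := by rw [hkdef, Matrix.mul_nonsing_inv_cancel_left _ _ hPunit]
  have hb₀ne : b₀ ≠ 0 := by
    intro h0
    apply hkdet'.ne_zero
    rw [hkdef, h0, map_zero, mul_zero, Matrix.det_zero]
  set x : Dˣ := (hD b₀ hb₀ne).unit with hxdef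
  have hx : (x : D) = b₀ := (hD b₀ hb₀ne).unit_spec
  -- the left order of `x O_(q)` in the conjugated model
  have hkey : ∀ h : D, h ∈ Brandt.leftOrder (x • localAt q O) ↔
      (∀ i j, ‖(P⁻¹ * Φ h * P) i j‖ ≤ 1) ∧ ‖(P⁻¹ * Φ h * P) 1 0‖ ≤ (q : ℝ) ^ (-(e : ℤ)) := by
    intro h
    rw [Brandt.mem_leftOrder_smul_localAt_iff hO1 hOmul, mem_units_smul_submodule_iff, Units.smul_def,
      smul_eq_mul, hO, map_mul, map_mul, ← Brandt.inv_map_units Φ x, hx, hΦb₀, Matrix.mul_inv_rev,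
      show k⁻¹ * P⁻¹ * (Φ h * (P * k)) = k⁻¹ * (P⁻¹ * Φ h * P) * k by simp only [Matrix.mul_assoc]]
    exact Padic.eichler_conj_iff hk hkinv (Matrix.mul_nonsing_inv k hkdet') _
  have hcop : ∀ w : ℚ, w.den.Coprime q ↔ ‖(w : ℚ_[q])‖ ≤ 1 := fun w => by
    rw [Padic.norm_ratCast_le_one_iff, Nat.coprime_comm, Nat.Prime.coprime_iff_not_dvd hq.out]
  refine ⟨x, ?_⟩
  ext h
  rw [Brandt.mem_optimalOrder_iff, Brandt.IsQuadOrder.mem_localAt_iff_of_monogenic hBσ]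
  constructor
  · rintro ⟨hL, hadj⟩
    obtain ⟨r, s, rfl⟩ := Brandt.exists_rat_eq_of_mem_adjoin hD hγ hadj
    have hE := (hkey _).mp hL
    rw [hconj r s, eichler_triangular_iff hlam₁1 hlam1] at hE
    exact ⟨r, s, (hcop r).mpr hE.1, (hcop s).mpr hE.2, rfl⟩
  · rintro ⟨r, s, hr, hs, rfl⟩
    refine ⟨(hkey _).mpr ?_, Brandt.ratCoords_mem_adjoin γ r s⟩
    rw [hconj r s, eichler_triangular_iff hlam₁1 hlam1]
    exact ⟨(hcop r).mp hr, (hcop s).mp hs⟩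

end Local

/-! ### §2 A split prime gives a `q`-adic integral root of `X² − tX − m` -/

section Root

variable {K : Type u} [Field K] [NumberField K]

/-- A `q`-adic root of a monic integer quadratic `X² − tX − m` is integral. [folklore] -/
private theorem padic_norm_le_one_of_root {q : ℕ} [Fact q.Prime] {t m : ℤ} {lam : ℚ_[q]}
    (hlam : lam * lam = (m : ℚ_[q]) + (t : ℚ_[q]) * lam) : ‖lam‖ ≤ 1 := by
  by_contra h
  push Not at h
  have hpos : 0 < ‖lam‖ := zero_lt_one.trans h
  have hle : ‖lam * lam‖ ≤ ‖lam‖ := by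
    rw [hlam]
    refine (Padic.nonarchimedean _ _).trans (max_le ((Padic.norm_int_le_one m).trans h.le) ?_)
    rw [norm_mul]
    exact mul_le_of_le_one_left hpos.le (Padic.norm_int_le_one t)
  rw [norm_mul] at hle
  nlinarith

/-- **A prime split in the quadratic field `K` yields a `q`-adic integral root of the minimal
polynomial `X² − tX − m` of `ω`** (`(1, ω)` a `ℤ`-basis of `𝓞 K`, `ω² = m + tω`): `d_K = t² + 4m`
is a square in `ℚ_q` — for odd `q` by the decomposition law `(d_K/q) = 1` and Hensel, for `q = 2`
by `d_K ≡ 1 (mod 8)` — and `λ = (t + √d_K)/2`. [folklore]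
[cite: NeukirchANT1999, Ch. I (8.5) Prop. and Ch. II (4.6)] -/
theorem exists_padic_root_of_ncard_primesOver_eq_two (h2 : finrank ℚ K = 2)
    (b : Basis (Fin 2) ℤ (𝓞 K)) (hb : b 0 = 1) {q : ℕ} [hq : Fact q.Prime]
    (hs : ((Ideal.span {(q : ℤ)}).primesOver (𝓞 K)).ncard = 2) :
    ∃ lam : ℚ_[q], ‖lam‖ ≤ 1 ∧
      lam * lam = ((b.repr (b 1 * b 1) 0 : ℤ) : ℚ_[q]) + ((b.repr (b 1 * b 1) 1 : ℤ) : ℚ_[q]) * lam := by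
  set t : ℤ := b.repr (b 1 * b 1) 1 with htdef
  set m : ℤ := b.repr (b 1 * b 1) 0 with hmdef
  have hdisc : NumberField.discr K = t ^ 2 + 4 * m := discr_eq_sq_add_four_mul b hb
  -- `d_K` is a `q`-adic square
  have hsq : IsSquare ((NumberField.discr K : ℤ) : ℚ_[q]) := by
    by_cases hq2 : q = 2
    · subst hq2
      have h8 : NumberField.discr K % 8 = 1 := (ncard_primesOver_two_eq_two_iff h2).mp hs
      exact Literature.NumberTheory.QuadraticForms.padic_isSquare_intCast_of_mod_eight rfl h8
    · have hJ : jacobiSym (NumberField.discr K) q = 1 :=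
        (ncard_primesOver_eq_two_iff_jacobiSym h2 hq.out hq2).mp hs
      have hnd : ¬ (q : ℤ) ∣ NumberField.discr K := fun hdvd => by
        have h0 : jacobiSym (NumberField.discr K) q = 0 := by
          rw [jacobiSym.mod_left, Int.emod_eq_zero_of_dvd hdvd, jacobiSym.zero_left hq.out.one_lt]
        rw [h0] at hJ
        exact zero_ne_one hJ
      exact Literature.NumberTheory.QuadraticForms.padic_isSquare_intCast_of_isSquare_zmod hq2 hnd
        (ZMod.isSquare_of_jacobiSym_eq_one hJ)
  obtain ⟨δ, hδ⟩ := hsq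
  rw [hdisc] at hδ
  push_cast at hδ
  refine ⟨((t : ℚ_[q]) + δ) / 2, ?_⟩
  have hroot : ((t : ℚ_[q]) + δ) / 2 * (((t : ℚ_[q]) + δ) / 2) = (m : ℚ_[q]) + (t : ℚ_[q]) * (((t : ℚ_[q]) + δ) / 2) := by
    linear_combination (1 / 4 : ℚ_[q]) * hδ.symm
  exact ⟨padic_norm_le_one_of_root hroot, hroot⟩

end Root

/-! ### §3 Local optimal embeddings of `f(𝓞_K)` at every prime, for an arbitrary level `N⁺` -/

section LocalK

variable {K : Type u} [Field K] [NumberField K] {Nplus Nminus : ℕ} (S : Brandt.XiSetup Nplus Nminus)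

/-- The algebra of a Brandt set-up is a division algebra. [folklore] -/
private theorem isUnit_of_ne_zero_setup : ∀ x : S.D, x ≠ 0 → IsUnit x := fun _ hx =>
  isUnit_of_isTotallyDefinite S.D S.isTotallyDefinite hx

omit [NumberField K] in
/-- `ω ∉ ℚ` for a `ℤ`-basis `(1, ω)` of `𝓞 K` (linear independence of the basis). [folklore] -/
private theorem ratCast_ne_basis_one [NumberField K] (b : Basis (Fin 2) ℤ (𝓞 K)) (hb : b 0 = 1) (q : ℚ) :
    (q : K) ≠ ((b 1 : 𝓞 K) : K) := by
  intro h
  have hd : (q.den : ℤ) ≠ 0 := by exact_mod_cast q.den_ne_zero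
  have h1 : (q : K) * ((q.den : ℤ) : K) = ((q.num : ℤ) : K) := by
    have e := Rat.mul_den_eq_num q
    rw [Int.cast_natCast, ← Rat.cast_natCast, ← Rat.cast_mul, e, Rat.cast_intCast]
  have hK : ((q.den : ℤ) : K) * ((b 1 : 𝓞 K) : K) = ((q.num : ℤ) : K) := by
    rw [← h, mul_comm]; exact h1
  have hO : (q.den : ℤ) • b 1 = (q.num : ℤ) • b 0 := by
    apply RingOfIntegers.ext
    rw [hb, zsmul_eq_mul, zsmul_eq_mul, mul_one]
    simp only [map_mul, map_intCast]
    exact hK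
  have hli := b.linearIndependent
  rw [Fintype.linearIndependent_iff] at hli
  have h0 := hli ![-(q.num : ℤ), (q.den : ℤ)] (by
    rw [Fin.sum_univ_two]
    simp only [Matrix.cons_val_zero, Matrix.cons_val_one]
    rw [hO, neg_smul, neg_add_cancel]) 1
  simp only [Matrix.cons_val_one] at h0
  exact hd h0

/-- `f(ω) ∉ ℚ` for an embedding `f : K → D`. [folklore] -/
private theorem algHom_basis_one_not_mem_bot {D : Type*} [Ring D] [Algebra ℚ D] [IsQuaternionAlgebra ℚ D]
    (b : Basis (Fin 2) ℤ (𝓞 K)) (hb : b 0 = 1) (f : K →ₐ[ℚ] D) :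
    f ((b 1 : 𝓞 K) : K) ∉ (⊥ : Subalgebra ℚ D) := by
  haveI : Nontrivial D := Brandt.nontrivial_of_isQuaternionAlgebra
  rw [Algebra.mem_bot]
  rintro ⟨q, hq⟩
  apply ratCast_ne_basis_one b hb q
  apply f.toRingHom.injective
  change f (q : K) = f _
  rw [← hq]
  exact f.commutes q

omit [NumberField K] in
/-- `ω² = m + t ω` in `K`, with `m, t` the coordinates of `ω²` in the basis `(1, ω)`. [folklore] -/
private theorem basis_one_mul_self_eq_cast [NumberField K] (b : Basis (Fin 2) ℤ (𝓞 K)) (hb : b 0 = 1) :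
    ((b 1 : 𝓞 K) : K) * ((b 1 : 𝓞 K) : K) =
      ((b.repr (b 1 * b 1) 0 : ℤ) : K) + ((b.repr (b 1 * b 1) 1 : ℤ) : K) * ((b 1 : 𝓞 K) : K) := by
  have h := congrArg (fun z : 𝓞 K => (z : K)) (basis_one_mul_self_eq b hb)
  simpa using h

/-- `f(ω)² = m + t f(ω)` in `D`, in the `algebraMap`/`•` form consumed by §1. [folklore] -/
private theorem algHom_basis_one_sq {D : Type*} [Ring D] [Algebra ℚ D] (b : Basis (Fin 2) ℤ (𝓞 K)) (hb : b 0 = 1)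
    (f : K →ₐ[ℚ] D) :
    f ((b 1 : 𝓞 K) : K) * f ((b 1 : 𝓞 K) : K) =
      algebraMap ℚ D ((b.repr (b 1 * b 1) 0 : ℤ) : ℚ) +
        (((b.repr (b 1 * b 1) 1 : ℤ) : ℚ)) • f ((b 1 : 𝓞 K) : K) := by
  set t : ℤ := b.repr (b 1 * b 1) 1 with htdef
  set m : ℤ := b.repr (b 1 * b 1) 0 with hmdef
  have h : ((b 1 : 𝓞 K) : K) * ((b 1 : 𝓞 K) : K) = ((m : ℤ) : K) + ((t : ℤ) : K) * ((b 1 : 𝓞 K) : K) :=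
    basis_one_mul_self_eq_cast b hb
  have hf : f (((b 1 : 𝓞 K) : K) * ((b 1 : 𝓞 K) : K)) = (m : D) + (t : D) * f ((b 1 : 𝓞 K) : K) := by
    rw [h, map_add, map_mul (f := f), map_intCast, map_intCast]
  rw [← map_mul (f := f), hf, Algebra.smul_def, ← map_intCast (algebraMap ℚ D) m,
    ← map_intCast (algebraMap ℚ D) t]

/-- Every element of the quadratic field is `u + v ω`. [folklore] -/
private theorem exists_rat_eq (h2 : finrank ℚ K = 2) (b : Basis (Fin 2) ℤ (𝓞 K)) (hb : b 0 = 1) (x : K) :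
    ∃ u v : ℚ, x = (u : K) + (v : K) * ((b 1 : 𝓞 K) : K) :=
  Literature.NumberTheory.QuadraticFields.QuadraticOrderLattice.exists_rat_add_rat_mul h2
    (ratCast_ne_basis_one b hb) x

/-- `f(u + v ω) = u + v f(ω)` for rational `u, v`. [folklore] -/
private theorem algHom_ratCoords {D : Type*} [Ring D] [Algebra ℚ D] (f : K →ₐ[ℚ] D) (ω : K) (u v : ℚ) :
    f ((u : K) + (v : K) * ω) = algebraMap ℚ D u + v • f ω := by
  rw [map_add, map_mul, show (u : K) = algebraMap ℚ K u from rfl, show (v : K) = algebraMap ℚ K v from rfl,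
    f.commutes, f.commutes, Algebra.smul_def]

/-- **At every prime `q ∤ N⁻` the Eichler order of a Brandt set-up has an Eichler matrix model of
level `q^{v_q(N⁺)}`**: `O_(q) = Φ⁻¹(ℤ_q ℤ_q; q^{v_q(N⁺)} ℤ_q ℤ_q)` (a matrix model exists at the
unramified `q`; the local normal form of an Eichler order of level `N⁺`, Vignéras II §2 Lemme 2.4;
NO square-freeness: the exponent is arbitrary, `0` when `q ∤ N⁺`).
[cite: VignerasLNM800, Ch. II §2 Lemme 2.4; Ch. III §5 Prop. 5.1] -/
theorem exists_levelModel_general {q : ℕ} [Fact q.Prime] (hqm : ¬ q ∣ Nminus) :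
    ∃ Φ : S.D →ₐ[ℚ] Matrix (Fin 2) (Fin 2) ℚ_[q],
      ∀ y : S.D, y ∈ localAt q S.O ↔
        (∀ i j, ‖Φ y i j‖ ≤ 1) ∧ ‖Φ y 1 0‖ ≤ (q : ℝ) ^ (-(Nplus.factorization q : ℤ)) := by
  have hram : ∀ v : HeightOneSpectrum (𝓞 ℚ),
      v ∈ ramifiedPlaces ℚ S.D ↔ ((Nminus : ℕ) : 𝓞 ℚ) ∈ v.asIdeal :=
    S.toEichlerPackage.mem_ramifiedPlaces_iff
  obtain ⟨φ⟩ := exists_algHom_matrix_of_not_dvd (B := S.D) hram hqm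
  obtain ⟨u, hu⟩ := S.toEichlerPackage.isEichlerOrder.exists_conjUnit_localAt_iff_eichler
    (isUnit_of_ne_zero_setup S) S.nplus_ne_zero φ
  exact ⟨AlgHom.conjUnit φ u, hu⟩

/-- **At a prime `q ∤ N⁻` SPLIT in `K` (any exponent `v_q(N⁺) ≥ 0`): a local ideal `x O_(q)` with
optimal order `f(𝓞_K)_(q)`** — §1 fed with the level model of exponent `v_q(N⁺)` and a `q`-adic root
of the minimal polynomial of `ω` (Eichler–Hijikata: the maximal order of `K_q = ℚ_q × ℚ_q` embeds
optimally into the Eichler order of level `q^e` for every `e`).  This is the case `q ∣ N⁺`,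
`q² ∣ N⁺` allowed, that `GrossPointsTowerExistence.exists_local_of_dvd_nplus` proves only for
`q ∥ N⁺`. [cite: Hijikata1974, §2] [cite: VignerasLNM800, Ch. III §5 Cor. 5.12] -/
theorem exists_local_of_split (h2 : finrank ℚ K = 2) (b : Basis (Fin 2) ℤ (𝓞 K)) (hb : b 0 = 1)
    (f : K →ₐ[ℚ] S.D) {q : ℕ} [hq : Fact q.Prime] (hqm : ¬ q ∣ Nminus)
    (hsplit : ((Ideal.span {(q : ℤ)}).primesOver (𝓞 K)).ncard = 2) :
    ∃ x : S.Dˣ, Brandt.optimalOrder (x • localAt q S.O) (f ((b 1 : 𝓞 K) : K)) =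
      localAt q (GrossPointTowerExistence.ordLat f 1) := by
  obtain ⟨Φ, hΦ⟩ := exists_levelModel_general S hqm
  obtain ⟨lam, hlam1, hlam⟩ := exists_padic_root_of_ncard_primesOver_eq_two h2 b hb hsplit
  exact exists_optimalOrder_smul_eq_of_eichler_of_root Φ (isUnit_of_ne_zero_setup S) hΦ
    S.isEichlerOrder.isOrder.one_mem S.isEichlerOrder.isOrder.mul_mem (algHom_basis_one_not_mem_bot b hb f)
    (algHom_basis_one_sq b hb f) hlam1 hlam
    (fun y => by rw [GrossPointTowerExistence.mem_ordLat_iff b hb f 1, Nat.cast_one, one_smul])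

/-- **Local optimal embeddings of `f(𝓞_K)` exist at every prime** under the definite Heegner
hypothesis for an ARBITRARY level `N⁺`: primes of `N⁺` split, primes of `N⁻` inert, `(N⁺N⁻, d_K) = 1`
(`q ∣ N⁻`: the tree's `exists_local_of_dvd_nminus`; `q ∣ N⁺`: `exists_local_of_split`; `q ∤ N`: the
tree's `exists_local_of_not_dvd`). [cite: VignerasLNM800, Ch. II §3; Ch. III §5 Cor. 5.12] [cite: BertoliniDarmon1996, Lemma 2.1] -/
theorem exists_local_general (h2 : finrank ℚ K = 2) (b : Basis (Fin 2) ℤ (𝓞 K)) (hb : b 0 = 1)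
    (f : K →ₐ[ℚ] S.D) (hcop : (Nplus * Nminus).Coprime (NumberField.discr K).natAbs)
    (hsplit : ∀ ℓ : ℕ, ℓ.Prime → ℓ ∣ Nplus → ((Ideal.span {(ℓ : ℤ)}).primesOver (𝓞 K)).ncard = 2)
    (q : ℕ) (hq : q.Prime) :
    ∃ x : S.Dˣ, Brandt.optimalOrder (x • localAt q S.O) (f ((b 1 : 𝓞 K) : K)) =
      localAt q (GrossPointTowerExistence.ordLat f 1) := by
  haveI := Fact.mk hq
  by_cases hqm : q ∣ Nminus
  · have hndisc : ¬ (q : ℤ) ∣ NumberField.discr K := fun h => by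
      have h' : q ∣ (NumberField.discr K).natAbs :=
        Int.natCast_dvd_natCast.mp (Int.dvd_natAbs.mpr h)
      exact hq.one_lt.ne' (Nat.Coprime.eq_one_of_dvd (hcop.of_dvd_left (hqm.mul_left Nplus)) h')
    exact GrossPointTowerExistence.exists_local_of_dvd_nminus S h2 b hb f hqm hndisc
  · by_cases hqp : q ∣ Nplus
    · exact exists_local_of_split S h2 b hb f hqm (hsplit q hq hqp)
    · have hqN : ¬ q ∣ Nplus * Nminus := fun h => ((Nat.Prime.dvd_mul hq).mp h).elim hqp hqm
      exact GrossPointTowerExistence.exists_local_of_not_dvd S h2 b hb f hqN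

end LocalK

/-! ### §4 Gross points of conductor `1` exist (BD96 Lemma 2.1 at `c = 1`, arbitrary `N⁺`) -/

section Global

variable {K : Type u} [Field K] [NumberField K] {Nplus Nminus : ℕ} (S : Brandt.XiSetup Nplus Nminus)

/-- **Gross points exist on a definite Shimura set of ANY level** (Bertolini–Darmon 1996, Lemma 2.1
with `c = 1`, "the theory of local embeddings ([Gr2], [Vi]) shows that `H_{N⁺,N⁻}(K; c)` is
non-empty"; Vignéras III §5 Thm. 5.11–Cor. 5.12; Gross 1987 §3): for a Brandt set-up `S` of type
`(N⁺, N⁻)` — `N⁺ ≥ 1` ARBITRARY (not necessarily square-free), `N⁻` the square-free discriminant — and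
an imaginary quadratic field `K` with `(N⁺N⁻, d_K) = 1`, every prime of `N⁺` split and every prime of
`N⁻` inert in `K`, there are an embedding `ψ : K → S.D` and an invertible right `S.O`-ideal `I` with
`ψ` an optimal embedding of `𝓞_K` into `O_L(I)`, i.e. `Brandt.IsGrossPoint S.O ψ I`.  Proof: `K ↪ D`
(`nonempty_algHom`), local optimal embeddings everywhere (`exists_local_general`), gluing
(`exists_invertible_optimalOrder_eq`), dictionary (`isGrossPoint_iff_isHeegner_one`).
[cite: BertoliniDarmon1996, Lemma 2.1] [cite: VignerasLNM800, Ch. III §5 Thm. 5.11, Cor. 5.12] [cite: Gross1987, §3] -/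
theorem exists_isGrossPoint (hK : IsImaginaryQuadratic K)
    (hcop : (Nplus * Nminus).Coprime (NumberField.discr K).natAbs)
    (hsplit : ∀ ℓ : ℕ, ℓ.Prime → ℓ ∣ Nplus → ((Ideal.span {(ℓ : ℤ)}).primesOver (𝓞 K)).ncard = 2)
    (hinert : ∀ ℓ : ℕ, ℓ.Prime → ℓ ∣ Nminus → ((Ideal.span {(ℓ : ℤ)}).primesOver (𝓞 K)).ncard = 1) :
    ∃ (ψ : K →ₐ[ℚ] S.D) (I : Submodule ℤ S.D), Brandt.IsGrossPoint S.O ψ I := by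
  classical
  haveI : Nontrivial S.D := Brandt.nontrivial_of_isQuaternionAlgebra
  haveI : IsAddTorsionFree S.D := S.isAddTorsionFree
  obtain ⟨b, hb⟩ := exists_basis_zero_eq_one hK.1
  have hcopm : ∀ ℓ : ℕ, ℓ.Prime → ℓ ∣ Nminus → ¬ (ℓ : ℤ) ∣ NumberField.discr K := fun ℓ hℓ hℓN h => by
    have h' : ℓ ∣ (NumberField.discr K).natAbs := Int.natCast_dvd_natCast.mp (Int.dvd_natAbs.mpr h)
    exact hℓ.one_lt.ne' (Nat.Coprime.eq_one_of_dvd (hcop.of_dvd_left (hℓN.mul_left Nplus)) h')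
  obtain ⟨f⟩ := GrossPointTowerExistence.nonempty_algHom S hK hcopm hinert
  set ω : K := ((b 1 : 𝓞 K) : K) with hωdef
  set γ : S.D := f ω with hγdef
  have hO := S.isEichlerOrder.isOrder
  have hOZ : IsZOrder S.O := S.toEichlerPackage.isEichlerOrder.isZOrder
  have hB : Brandt.IsQuadOrder γ (GrossPointTowerExistence.ordLat f 1) :=
    GrossPointTowerExistence.isQuadOrder_ordLat_one hK.1 b hb f
  have hloc := exists_local_general S hK.1 b hb f hcop hsplit
  obtain ⟨w₀, hw₀⟩ := hloc 2 Nat.prime_two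
  obtain ⟨J, hJinv, hJB, -⟩ :=
    GrossPointTowerExistence.exists_invertible_optimalOrder_eq hO hB hloc Nat.prime_two w₀ hw₀
  refine ⟨f, J, isGrossPoint_iff_isHeegner_one.mpr
    ⟨mem_rightIdeals_of_isInvertibleRightIdeal (isUnit_of_ne_zero_setup S) hOZ hJinv, fun x => ?_⟩⟩
  change f x ∈ Brandt.leftOrder J ↔ x ∈ quadOrder K 1
  constructor
  · intro hx
    obtain ⟨u, v, rfl⟩ := exists_rat_eq hK.1 b hb x
    have hadj : f ((u : K) + (v : K) * ω) ∈ Algebra.adjoin ℚ {γ} := by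
      rw [algHom_ratCoords]; exact Brandt.ratCoords_mem_adjoin γ u v
    have hmem : f ((u : K) + (v : K) * ω) ∈ Brandt.optimalOrder J γ :=
      Brandt.mem_optimalOrder_iff.mpr ⟨hx, hadj⟩
    rw [hJB] at hmem
    obtain ⟨a, ha, hfa⟩ := GrossRep.mem_embLattice_iff.mp hmem
    rw [← f.toRingHom.injective hfa]
    exact ha
  · intro hx
    have hmem : f x ∈ GrossPointTowerExistence.ordLat f 1 := GrossRep.apply_mem_embLattice f hx
    rw [← hJB] at hmem
    exact Brandt.optimalOrder_le_leftOrder _ _ hmem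

/-- **`H_{N⁺,N⁻}(K; 1) ≠ ∅` for arbitrary `N⁺`**: the set `grossPoints K S 1` of Gross points of
conductor `1` on the definite Shimura set of `S` is non-empty (the class of the pair of
`exists_isGrossPoint`, through `mk_mem_grossPoints_one_iff`). [cite: BertoliniDarmon1996, Lemma 2.1] -/
theorem grossPoints_one_nonempty (hK : IsImaginaryQuadratic K)
    (hcop : (Nplus * Nminus).Coprime (NumberField.discr K).natAbs)
    (hsplit : ∀ ℓ : ℕ, ℓ.Prime → ℓ ∣ Nplus → ((Ideal.span {(ℓ : ℤ)}).primesOver (𝓞 K)).ncard = 2)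
    (hinert : ∀ ℓ : ℕ, ℓ.Prime → ℓ ∣ Nminus → ((Ideal.span {(ℓ : ℤ)}).primesOver (𝓞 K)).ncard = 1) :
    (grossPoints K S 1).Nonempty := by
  obtain ⟨ψ, I, h⟩ := exists_isGrossPoint S hK hcop hsplit hinert
  exact ⟨_, h.mk_mem_grossPoints_one⟩

end Global

end GrossPointsGeneralLevel

end Literature.NumberTheory.EllipticCurves

end
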